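import Mathlib
import Literature.Geometry.Lorentzian.Basic

/-!
# Route EIHFluxBalance — `ModulatedKerrHandoff`: the retarded clock of a slow world-line

Helper file for the crux `stmt-FinalStateConjecture-10167`
(`Summit.FinalStateConjecture.FinalStateConjecture.Theses.EIHFluxBalance.ModulatedKerrHandoff`),
line `photon-rocket-modulation`, registered stub `stub_retardedClock` (S2).

For a smooth world-line `u ↦ (u, ξ u)` in `E4 = ℝ × ℝ³` of speed `‖ξ̇‖ ≤ v < 1`, the RETARDED TIME
`U x` of an event `x ∈ E4` is the unique `u` with `x⁰ − u = ‖x̲ − ξ(u)‖` (the past light cone of `x`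
meets the world-line exactly once), and `U` is `C^∞` off the world-line `{x̲ = ξ(U x)}`.

* `retardedClock_norm_sub_le` — `‖ξ a − ξ b‖ ≤ v |a − b|` (mean value inequality);
* `retardedClock_unique` — two solutions of the clock equation coincide
  (`|u − u'| ≤ ‖ξ u − ξ u'‖ ≤ v |u − u'|`, `v < 1`);
* `retardedClock_exists` — a solution exists (intermediate value theorem for the continuous
  `u ↦ x⁰ − u − ‖x̲ − ξ u‖`, which is `≤ 0` at `u = x⁰` and `≥ 0` at `u = x⁰ − ‖x̲ − ξ x⁰‖/(1 − v)`);
* `retardedClock_local` — near a solution `(x₀, u₀)` off the world-line the clock equation has a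
  `C^∞` local solution (implicit function theorem, `ContDiffAt.implicitFunction`: the `u`-derivative
  of `u + ‖x̲ − ξ u‖ − x⁰` is `1 + ∂_u‖x̲ − ξ u‖ ≥ 1 − v > 0`);
* `retardedClock_contDiffAt` / `retardedClock_contDiffOn` — ANY solution `U` of the clock equation
  is `C^∞` at every `x` with `x̲ ≠ ξ(U x)` (it agrees with the local solution near `x`, by uniqueness);
* `stub_retardedClock` — the registered one-line form.

Kinnersley, Phys. Rev. 186 (1969) 1335, §2; Hogan–Puetzfeld, arXiv:2007.04685, §2
(retarded-time construction). [folklore calculus]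
-/

noncomputable section

set_option linter.dupNamespace false

open scoped Manifold ContDiff Topology ENNReal NNReal
open Filter Set TopologicalSpace Literature.Geometry.Lorentzian

namespace Summit.FinalStateConjecture.FinalStateConjecture.Cruxes.ModulatedKerrHandoff.PhotonRocketModulation

/-- A smooth world-line with `‖ξ̇‖ ≤ v` is `v`-Lipschitz: `‖ξ a − ξ b‖ ≤ v · |a − b|` (mean value
inequality). [folklore] -/
theorem retardedClock_norm_sub_le {ξ : ℝ → E3} {v : ℝ} (hξ : ContDiff ℝ ∞ ξ)
    (hdξ : ∀ t, ‖deriv ξ t‖ ≤ v) (a b : ℝ) : ‖ξ a - ξ b‖ ≤ v * |a - b| := by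
  have hd : Differentiable ℝ ξ := hξ.differentiable (by simp)
  have h := Convex.norm_image_sub_le_of_norm_deriv_le (s := Set.univ) (fun x _ ↦ hd x)
    (fun x _ ↦ hdξ x) convex_univ (Set.mem_univ b) (Set.mem_univ a)
  simpa [Real.norm_eq_abs] using h

/-- Uniqueness of the retarded time: two solutions `u, u'` of `x⁰ − u = ‖x̲ − ξ u‖` coincide when
`ξ` is `v`-Lipschitz with `v < 1` (`|u − u'| ≤ ‖ξ u − ξ u'‖ ≤ v |u − u'|`). [folklore] -/
theorem retardedClock_unique {ξ : ℝ → E3} {v : ℝ} (hv1 : v < 1)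
    (hvd : ∀ a b, ‖ξ a - ξ b‖ ≤ v * |a - b|) {x : E4} {u u' : ℝ}
    (hu : x 0 - u = ‖E4.spatial x - ξ u‖) (hu' : x 0 - u' = ‖E4.spatial x - ξ u'‖) :
    u = u' := by
  have h1 : |u' - u| ≤ v * |u' - u| := by
    have h2 : u' - u = ‖E4.spatial x - ξ u‖ - ‖E4.spatial x - ξ u'‖ := by linarith
    calc |u' - u| = |‖E4.spatial x - ξ u‖ - ‖E4.spatial x - ξ u'‖| := by rw [h2]
      _ ≤ ‖(E4.spatial x - ξ u) - (E4.spatial x - ξ u')‖ := abs_norm_sub_norm_le _ _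
      _ = ‖ξ u' - ξ u‖ := by congr 1; abel
      _ ≤ v * |u' - u| := hvd u' u
  have h3 : |u' - u| ≤ 0 := by nlinarith [abs_nonneg (u' - u)]
  have h4 : u' - u = 0 := abs_nonpos_iff.mp h3
  linarith

/-- Existence of the retarded time: `u ↦ x⁰ − u − ‖x̲ − ξ u‖` is continuous, `≤ 0` at `u = x⁰`
and `≥ 0` at `u = x⁰ − ‖x̲ − ξ x⁰‖ / (1 − v)`, so it vanishes somewhere (intermediate value
theorem). [folklore] -/
theorem retardedClock_exists {ξ : ℝ → E3} {v : ℝ} (hc : Continuous ξ) (hv1 : v < 1)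
    (hvd : ∀ a b, ‖ξ a - ξ b‖ ≤ v * |a - b|) (x : E4) :
    ∃ u : ℝ, x 0 - u = ‖E4.spatial x - ξ u‖ := by
  set D : ℝ := ‖E4.spatial x - ξ (x 0)‖ with hD
  have h1v : 0 < 1 - v := by linarith
  have hD0 : 0 ≤ D := norm_nonneg _
  set R : ℝ := D / (1 - v) with hR
  have hR0 : 0 ≤ R := div_nonneg hD0 h1v.le
  have hRD : R - v * R = D := by
    rw [hR]
    field_simp
  let F : ℝ → ℝ := fun u ↦ x 0 - u - ‖E4.spatial x - ξ u‖
  have hF : Continuous F := by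
    fun_prop
  have ha : F (x 0) ≤ 0 := by
    show x 0 - x 0 - ‖E4.spatial x - ξ (x 0)‖ ≤ 0
    have := norm_nonneg (E4.spatial x - ξ (x 0))
    linarith
  have hb : 0 ≤ F (x 0 - R) := by
    have h1 : ‖E4.spatial x - ξ (x 0 - R)‖ ≤ D + v * R := by
      have h2 := hvd (x 0) (x 0 - R)
      have habs : |x 0 - (x 0 - R)| = R := by rw [sub_sub_cancel, abs_of_nonneg hR0]
      rw [habs] at h2
      calc ‖E4.spatial x - ξ (x 0 - R)‖
          = ‖(E4.spatial x - ξ (x 0)) + (ξ (x 0) - ξ (x 0 - R))‖ := by congr 1; abel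
        _ ≤ ‖E4.spatial x - ξ (x 0)‖ + ‖ξ (x 0) - ξ (x 0 - R)‖ := norm_add_le _ _
        _ ≤ D + v * R := add_le_add le_rfl h2
    show 0 ≤ x 0 - (x 0 - R) - ‖E4.spatial x - ξ (x 0 - R)‖
    linarith
  obtain ⟨u, hu⟩ : (0 : ℝ) ∈ Set.range F := intermediate_value_univ (x 0) (x 0 - R) hF ⟨ha, hb⟩
  refine ⟨u, ?_⟩
  have hu' : x 0 - u - ‖E4.spatial x - ξ u‖ = 0 := hu
  linarith

/-- Local smooth solutions of the clock equation (implicit function theorem). Near a point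
`(x₀, u₀)` off the world-line (`x̲₀ ≠ ξ u₀`) the level set of `f(x, u) = u + ‖x̲ − ξ u‖ − x⁰`
through `(x₀, u₀)` is the graph of a function `ψ`, `C^∞` at `x₀`: `f` is `C^∞` near `(x₀, u₀)`
(the norm is smooth off `0`) and `∂_u f = 1 + ∂_u ‖x̲₀ − ξ u‖ ≥ 1 − v > 0` because
`u ↦ ‖x̲₀ − ξ u‖` is `v`-Lipschitz. Mathlib: `ContDiffAt.implicitFunction`,
`ContDiffAt.contDiffAt_implicitFunction`, `ContDiffAt.eventually_apply_implicitFunction`.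
[folklore] -/
theorem retardedClock_local {ξ : ℝ → E3} {v : ℝ} (hξ : ContDiff ℝ ∞ ξ) (hv0 : 0 ≤ v)
    (hv1 : v < 1) (hvd : ∀ a b, ‖ξ a - ξ b‖ ≤ v * |a - b|) {x₀ : E4} {u₀ : ℝ}
    (hne : E4.spatial x₀ ≠ ξ u₀) :
    ∃ ψ : E4 → ℝ, ContDiffAt ℝ ∞ ψ x₀ ∧
      ∀ᶠ x in 𝓝 x₀, x 0 - ψ x - ‖E4.spatial x - ξ (ψ x)‖ =
        x₀ 0 - u₀ - ‖E4.spatial x₀ - ξ u₀‖ := by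
  have hn : (∞ : WithTop ℕ∞) ≠ 0 := by simp
  set f : E4 × ℝ → ℝ := fun q ↦ q.2 + ‖E4.spatial q.1 - ξ q.2‖ - q.1 0 with hf_def
  have hsub0 : E4.spatial x₀ - ξ u₀ ≠ 0 := sub_ne_zero.mpr hne
  have hf : ContDiffAt ℝ ∞ f (x₀, u₀) := by
    have h1 : ContDiff ℝ ∞ (fun q : E4 × ℝ ↦ E4.spatial q.1 - ξ q.2) :=
      (E4.spatial.contDiff.comp contDiff_fst).sub (hξ.comp contDiff_snd)
    have h2 : ContDiffAt ℝ ∞ (fun q : E4 × ℝ ↦ ‖E4.spatial q.1 - ξ q.2‖) (x₀, u₀) :=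
      h1.contDiffAt.norm ℝ hsub0
    have h3 : ContDiff ℝ ∞ (fun q : E4 × ℝ ↦ q.1 0) := by fun_prop
    exact (contDiffAt_snd.add h2).sub h3.contDiffAt
  -- the partial `u`-derivative of `f` at `(x₀, u₀)` is positive
  have hL : 0 < (fderiv ℝ f (x₀, u₀) ∘L ContinuousLinearMap.inr ℝ E4 ℝ) 1 := by
    have hfd : HasFDerivAt f (fderiv ℝ f (x₀, u₀)) (x₀, u₀) :=
      (hf.differentiableAt hn).hasFDerivAt
    have hg : HasFDerivAt (fun u : ℝ ↦ (x₀, u)) (ContinuousLinearMap.inr ℝ E4 ℝ) u₀ :=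
      hasFDerivAt_prodMk_right x₀ u₀
    have hcomp : HasDerivAt (fun u : ℝ ↦ f (x₀, u))
        ((fderiv ℝ f (x₀, u₀) ∘L ContinuousLinearMap.inr ℝ E4 ℝ) 1) u₀ :=
      (hfd.comp u₀ hg).hasDerivAt
    have hnd : DifferentiableAt ℝ (fun u : ℝ ↦ ‖E4.spatial x₀ - ξ u‖) u₀ :=
      ((contDiff_const.sub hξ).contDiffAt.norm ℝ hsub0).differentiableAt hn
    have hderiv2 : HasDerivAt (fun u : ℝ ↦ f (x₀, u))
        (1 + deriv (fun u : ℝ ↦ ‖E4.spatial x₀ - ξ u‖) u₀) u₀ :=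
      ((hasDerivAt_id' u₀).add hnd.hasDerivAt).sub_const (x₀ 0)
    have hL1 := hcomp.unique hderiv2
    have hlip : LipschitzWith ⟨v, hv0⟩ (fun u : ℝ ↦ ‖E4.spatial x₀ - ξ u‖) := by
      refine LipschitzWith.of_dist_le_mul fun a b ↦ ?_
      rw [Real.dist_eq, Real.dist_eq]
      calc |‖E4.spatial x₀ - ξ a‖ - ‖E4.spatial x₀ - ξ b‖|
          ≤ ‖(E4.spatial x₀ - ξ a) - (E4.spatial x₀ - ξ b)‖ := abs_norm_sub_norm_le _ _
        _ = ‖ξ b - ξ a‖ := by congr 1; abel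
        _ ≤ v * |b - a| := hvd b a
        _ = ((⟨v, hv0⟩ : ℝ≥0) : ℝ) * |a - b| := by rw [abs_sub_comm]
    have hdle : |deriv (fun u : ℝ ↦ ‖E4.spatial x₀ - ξ u‖) u₀| ≤ v := by
      have h := norm_deriv_le_of_lipschitz (x₀ := u₀) hlip
      rw [Real.norm_eq_abs] at h
      exact h
    rw [hL1]
    have := neg_abs_le (deriv (fun u : ℝ ↦ ‖E4.spatial x₀ - ξ u‖) u₀)
    linarith
  have if₂ : (fderiv ℝ f (x₀, u₀) ∘L ContinuousLinearMap.inr ℝ E4 ℝ).IsInvertible := by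
    refine ⟨ContinuousLinearEquiv.unitsEquivAut ℝ (Units.mk0 _ hL.ne'), ?_⟩
    exact ContinuousLinearMap.ext_ring (by simp)
  refine ⟨hf.implicitFunction hn if₂, hf.contDiffAt_implicitFunction hn if₂, ?_⟩
  have hev := hf.eventually_apply_implicitFunction hn if₂
  filter_upwards [hev] with x hx
  have hx' : hf.implicitFunction hn if₂ x
      + ‖E4.spatial x - ξ (hf.implicitFunction hn if₂ x)‖ - x 0
      = u₀ + ‖E4.spatial x₀ - ξ u₀‖ - x₀ 0 := hx
  linarith

/-- Smoothness of the retarded clock off the world-line, pointwise form: ANY solution `U` of the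
clock equation `x⁰ − U x = ‖x̲ − ξ(U x)‖` is `C^∞` at every `x₀` with `x̲₀ ≠ ξ(U x₀)`, because it
agrees near `x₀` with the local implicit-function solution (global uniqueness of the retarded
time). [folklore] -/
theorem retardedClock_contDiffAt {ξ : ℝ → E3} {v : ℝ} (hξ : ContDiff ℝ ∞ ξ) (hv0 : 0 ≤ v)
    (hv1 : v < 1) (hdξ : ∀ t, ‖deriv ξ t‖ ≤ v) {U : E4 → ℝ}
    (hU : ∀ x : E4, x 0 - U x = ‖E4.spatial x - ξ (U x)‖) {x₀ : E4}
    (hx₀ : E4.spatial x₀ ≠ ξ (U x₀)) : ContDiffAt ℝ ∞ U x₀ := by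
  have hvd := retardedClock_norm_sub_le hξ hdξ
  obtain ⟨ψ, hψ, hev⟩ := retardedClock_local hξ hv0 hv1 hvd hx₀
  refine hψ.congr_of_eventuallyEq ?_
  filter_upwards [hev] with x hx
  have h0 : x₀ 0 - U x₀ - ‖E4.spatial x₀ - ξ (U x₀)‖ = 0 := by rw [hU x₀, sub_self]
  have hψx : x 0 - ψ x = ‖E4.spatial x - ξ (ψ x)‖ := by linarith
  exact retardedClock_unique hv1 hvd (hU x) hψx

/-- Smoothness of the retarded clock off the world-line: any solution `U` of the clock equation is
`C^∞` on `{x | x̲ ≠ ξ(U x)}`. [folklore] -/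
theorem retardedClock_contDiffOn {ξ : ℝ → E3} {v : ℝ} (hξ : ContDiff ℝ ∞ ξ) (hv0 : 0 ≤ v)
    (hv1 : v < 1) (hdξ : ∀ t, ‖deriv ξ t‖ ≤ v) {U : E4 → ℝ}
    (hU : ∀ x : E4, x 0 - U x = ‖E4.spatial x - ξ (U x)‖) :
    ContDiffOn ℝ ∞ U {x : E4 | E4.spatial x ≠ ξ (U x)} :=
  fun _ hx ↦ (retardedClock_contDiffAt hξ hv0 hv1 hdξ hU hx).contDiffWithinAt

/-- S2 · RETARDED CLOCK (registered stub of line `photon-rocket-modulation`). For a smooth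
world-line `ξ : ℝ → E3` of speed `≤ v < 1`, every event `x ∈ E4` has a unique retarded time `u`
(`x⁰ − u = ‖x̲ − ξ(u)‖`), and there is a retarded-time function, `C^∞` off the world-line.
Kinnersley, Phys. Rev. 186 (1969) 1335, §2; Hogan–Puetzfeld arXiv:2007.04685 §2. [folklore] -/
theorem stub_retardedClock :
    ∀ (ξ : ℝ → E3) (v : ℝ), ContDiff ℝ ((⊤ : ℕ∞) : WithTop ℕ∞) ξ → 0 ≤ v → v < 1 →
      (∀ t, ‖deriv ξ t‖ ≤ v) →
        (∀ x : E4, ∃! u : ℝ, x 0 - u = ‖E4.spatial x - ξ u‖) ∧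
        ∃ U : E4 → ℝ, (∀ x : E4, x 0 - U x = ‖E4.spatial x - ξ (U x)‖) ∧
          ContDiffOn ℝ ((⊤ : ℕ∞) : WithTop ℕ∞) U {x : E4 | E4.spatial x ≠ ξ (U x)} := by
  intro ξ v hξ hv0 hv1 hdξ
  have hvd := retardedClock_norm_sub_le hξ hdξ
  have hex : ∀ x : E4, ∃ u : ℝ, x 0 - u = ‖E4.spatial x - ξ u‖ :=
    fun x ↦ retardedClock_exists hξ.continuous hv1 hvd x
  refine ⟨fun x ↦ ?_, fun x ↦ (hex x).choose, fun x ↦ (hex x).choose_spec, ?_⟩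
  · obtain ⟨u, hu⟩ := hex x
    exact ⟨u, hu, fun u' hu' ↦ retardedClock_unique hv1 hvd hu' hu⟩
  · exact retardedClock_contDiffOn hξ hv0 hv1 hdξ fun x ↦ (hex x).choose_spec

end Summit.FinalStateConjecture.FinalStateConjecture.Cruxes.ModulatedKerrHandoff.PhotonRocketModulation
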